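/-
Copyright: lit-balaban Phase-2 proof seat p30 (gen 28).  Statement-level skeleton of a published paper; no proof claims beyond what
the kernel checks below.
-/
import Literature.MathematicalPhysics.QuantumFieldTheory.BalabanImbrieJaffe1984to88.BIJ88NeumannPropagatorSmallFieldCloseDeriv
import Literature.MathematicalPhysics.QuantumFieldTheory.BalabanImbrieJaffe1984to88.BIJ88NeumannPropagatorSmallFieldSupDecay

/-!
# [BalabanImbrieJaffe1985] §7.3 p. 326 ⟵ [Balaban1983RegularityDecay] Theorem p. 573, (1.11)–(1.12): **THE `δG_k(□, T)` VALUE AND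
# COVARIANT-DERIVATIVE MEMBERS FOR A TORUS CUBE `□` AGAINST THE WHOLE TORUS, HYPOTHESIS-FREE UNDER THE BLOCK-SCALE PLAQUETTE SMALLNESS
# `(L^{2k}θ)² ≤ 1/500` ALONE** (instances of gen 27's `close112_smallField_of_inputs` and gen 28's `close112_smallField_deriv_of_inputs` with the
four (H1.10″) inputs discharged BY NAME: p27's torus and cube value members, gen 25's torus derivative member, p34's cube derivative member)

T. Bałaban, J. Imbrie, A. Jaffe, *Renormalization of the Higgs model: minimizers, propagators and the stability of mean field theory*,
Commun. Math. Phys. **97** (1985) 299–329 [BalabanImbrieJaffe1985], row **C1.Eq7.3.1-7.3.2** (owner r15) / front **C2S14** (owner r18);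
[7] = T. Bałaban, *Regularity and decay of lattice Green's functions*, Commun. Math. Phys. **89** (1983) 571–597 [Balaban1983RegularityDecay].

statement-level skeleton of published theorems with citation tags; proofs where landed; nothing here is a claim about the Yang–Mills mass gap

PDFs held and re-read this session: `paper:balaban1983-cmp89-regularity-decay` p. 573 = PDF 3, the Theorem (1.10)–(1.12);
`paper:balaban1985-cmp97-bij-higgs-minimizers` p. 326 = PDF 28, lines 18–22: *"The propagators arising from Δ_k(u_k), under the restriction
(7.3.1) on the gauge field, also satisfy the regularity and decay estimates of [7]."*

WHAT THIS FILE PROVES.  For `2 ≤ d′ = d + 1 ≤ 3`, `L = ℓ + 1` odd `≥ 3`, `a > 0` there are constants `c, δ > 0` (depending on `(d, ℓ, a)` only)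
such that on every torus of the series, at every level `1 ≤ k ≤ K` with `2(L^k − 1) + 4 < |T^{(0)}|`, for every `U(1)` field `u` with
`‖u(∂p) − 1‖ ≤ θ`, `0 ≤ θ`, `(L^{2k}θ)² ≤ 1/500` (p31's unified threshold), and every torus cube `□ = c·L^k + Π_i[0, L^kM_i)` (`M_i ≥ 1`, fitting,
shorter than the torus) — `G_k(X,u) = gBox (α_kL^{kd′}) ε⁻¹ u k X`, `f` supported in `□`, `F = ‖f‖_∞`, `D ≤ dist(x, supp f)`, `D_b ≤ dist(x, □^c)`,
`D_f ≤ dist(supp f, □^c)`: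
* **`close112_smallPlaquette_cube_torus`** — at the rows `x ∈ □` with `dist_∞(x, T ∖ □) ≥ 10L^k`:
  `‖(G_k(□,u)f)(x) − (G_k(T,u)f)(x)‖ ≤ (L^kε)²·c e^{−δD/L^k}e^{−δ(D_b+D_f)/L^k}·F`;
* **`close112_smallPlaquette_cube_torus_deriv`** — at the rows `x ∈ □` with `dist_∞(x, T ∖ □) ≥ 14L^k`, every `μ`:
  `‖covD ε⁻¹ u (G_k(□,u)f) ⟨x,μ⟩ − covD ε⁻¹ u (G_k(T,u)f) ⟨x,μ⟩‖ ≤ (L^kε)·c e^{−δD/L^k}e^{−δ(D_b+D_f)/L^k}·F`.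
The inputs, BY NAME: `BIJ85ScalarPropagatorSupDecay.decay110_smallField_input` (torus value, p27),
`BIJ88NeumannPropagatorSmallFieldSupDecay.decay110_smallPlaquette_cube_uniform` (cube value under (7.3.1), p27),
`BIJ85ScalarPropagatorSupDecayDeriv.decay110_smallField_deriv` (torus covariant derivative, gen 25),
`BIJ88NeumannPropagatorSmallFieldCubeDeriv.decay110_smallPlaquette_cube_deriv_uniform_input` (cube covariant derivative under (7.3.1), p34),
at the common constants `max / min`; the thresholds of the cube members follow from `(L^{2k}θ)² ≤ 1/500` by the arithmetic of p31's
`BIJ88DeltaLocSmallPlaquetteTorusCwt.smallness_of_threshold` (re-proved here privately so that this propagator-level file stays below the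
(2.30)–(2.41) chain in the import order).

(The packaging of these two members with the two torus (1.10) inputs at ONE set of constants, in the binder shapes (H1)–(H4) of p29's
`BIJ88LocDeriv231TorusOfInputs.deriv231_wholeTorus_of_inputs`, is p29's `BIJ88LocDeriv231SmallPlaquetteTorus` — not repeated here.)

HONEST SCOPE.  `U(1)`; `2 ≤ d′ ≤ 3`; `L` odd `≥ 3` (p34's cube member wants `L > 1` odd, p27's `ℓ ≥ 1`); `1 ≤ k ≤ K`; only the pair (torus cube,
whole torus) — general nested block unions need the region members (p34/p27 `…Region…`) in the same binder shapes and are not instantiated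
here; rows at OUR depths `10L^k` / `14L^k`; block-scale plaquette smallness as stated (stronger than (7.3.1) at large `L^{2k}`; that the
induction's backgrounds meet it is p33's lane).  Method divergence from [7] as disclosed in the two member files.  Nothing here is summit
progress.  Unit `lit-balaban-p30` (literature-prover-lit-balaban-p30-g28-0), HOME `run/shared/lean/pub/lit-balaban/`, 2026-08-23.
-/

open scoped BigOperators ComplexConjugate
open Finset Matrix

namespace Literature.MathematicalPhysics.QuantumFieldTheory.BalabanImbrieJaffe1984to88.BIJ88NeumannPropagatorSmallFieldCloseCubeTorus

open Literature.MathematicalPhysics.QuantumFieldTheory.Balaban1983to89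
open LatticeFieldCalculus (supDist)
open BIJ88Sect3Statements (U1 toC cfg covD norm_toC)
open BIJ85AbelianStokes (plaqC plaqC_eq_toC_plaqHol)
open BIJ88NeumannNoZeroModesTorus (IsBlockUnion isBlockUnion_univ)
open BIJ88NeumannPropagator227Torus (gBox)
open BIJ88NeumannPropagatorFlatDecayCube (cubeT isBlockUnion_cubeT)
open BIJ85ScalarPropagatorSupDecay (decay110_smallField_input)
open BIJ85ScalarPropagatorSupDecayDeriv (decay110_smallField_deriv)
open BIJ88NeumannPropagatorSmallFieldSupDecay (decay110_smallPlaquette_cube_uniform)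
open BIJ88NeumannPropagatorSmallFieldCubeDeriv (decay110_smallPlaquette_cube_deriv_uniform_input)
open BIJ88NeumannPropagatorSmallFieldClose (close112_smallField_of_inputs)
open BIJ88NeumannPropagatorSmallFieldCloseDeriv (close112_smallField_deriv_of_inputs)

noncomputable section

variable {P : Params}

/-! ## §1 Kernel lemmas: monotonicity in the constants, the threshold arithmetic -/

/-- kernel: weakening the constants of a decay bound, `c ≤ c′`, `δ′ ≤ δ`, `E, F ≥ 0`: `c·e^{−δE}·F ≤ c′·e^{−δ′E}·F`. [folklore] -/
private theorem mono_bound {c c' δ δ' E F : ℝ} (hc : 0 ≤ c) (hcc : c ≤ c') (hδ : δ' ≤ δ) (hE : 0 ≤ E) (hF : 0 ≤ F) :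
    c * Real.exp (-(δ * E)) * F ≤ c' * Real.exp (-(δ' * E)) * F :=
  mul_le_mul_of_nonneg_right (mul_le_mul hcc (Real.exp_le_exp.2 (neg_le_neg (mul_le_mul_of_nonneg_right hδ hE))) (Real.exp_pos _).le
    (hc.trans hcc)) hF

/-- kernel (the arithmetic of p31's `BIJ88DeltaLocSmallPlaquetteTorusCwt.smallness_of_threshold`, repeated to keep the import order): the
block-scale plaquette threshold `(L^{2k}θ)² ≤ 1/500` implies, for `1 ≤ d′ ≤ 3`, `2d′³(L^{2k}θ)² ≤ 1` and, with `T = (d′−1)(L^k−1)θ`,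
`2(L^k−1)L^k·d′·T² + 2(d′(L^k−1)T)² ≤ ½`. [cite: BalabanImbrieJaffe1985, (7.3.1) p.326] -/
private theorem threshold_smallness {dr n θ : ℝ} (hd1 : 1 ≤ dr) (hd3 : dr ≤ 3) (hn : 1 ≤ n) (hθ : 0 ≤ θ)
    (hτ : (n ^ 2 * θ) ^ 2 ≤ 1 / 500) :
    2 * dr ^ 3 * (n ^ 2 * θ) ^ 2 ≤ 1 ∧
      2 * ((n - 1) * n) * dr * ((dr - 1) * (n - 1) * θ) ^ 2 + 2 * (dr * (n - 1) * ((dr - 1) * (n - 1) * θ)) ^ 2 ≤ 1 / 2 := by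
  have hd0 : 0 ≤ dr := by linarith
  have hn0 : 0 ≤ n := by linarith
  have hd27 : dr ^ 3 ≤ 27 := by
    have h := pow_le_pow_left₀ hd0 hd3 3
    norm_num at h
    exact h
  have hd81 : dr ^ 4 ≤ 81 := by
    have h := pow_le_pow_left₀ hd0 hd3 4
    norm_num at h
    exact h
  have hτ0 : 0 ≤ (n ^ 2 * θ) ^ 2 := sq_nonneg _
  refine ⟨?_, ?_⟩
  · calc 2 * dr ^ 3 * (n ^ 2 * θ) ^ 2 ≤ 2 * 27 * (1 / 500) :=
          mul_le_mul (mul_le_mul_of_nonneg_left hd27 (by norm_num)) hτ hτ0 (by norm_num)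
      _ ≤ 1 := by norm_num
  · have hn1 : n - 1 ≤ n := by linarith
    have hdr1 : dr - 1 ≤ dr := by linarith
    have hn10 : 0 ≤ n - 1 := by linarith
    have hdr10 : 0 ≤ dr - 1 := by linarith
    calc 2 * ((n - 1) * n) * dr * ((dr - 1) * (n - 1) * θ) ^ 2 + 2 * (dr * (n - 1) * ((dr - 1) * (n - 1) * θ)) ^ 2
        ≤ 2 * (n * n) * dr * (dr * n * θ) ^ 2 + 2 * (dr * n * (dr * n * θ)) ^ 2 := by gcongr
      _ = (2 * dr ^ 3 + 2 * dr ^ 4) * (n ^ 2 * θ) ^ 2 := by ring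
      _ ≤ (2 * 27 + 2 * 81) * (1 / 500) := mul_le_mul (by linarith) hτ hτ0 (by norm_num)
      _ ≤ 1 / 2 := by norm_num

/-! ## §2 The value member for (torus cube, whole torus), hypothesis-free -/

/-- **[Balaban1983RegularityDecay] (1.11)–(1.12), VALUE MEMBER, FOR A TORUS CUBE AGAINST THE WHOLE TORUS AT A SMALL-PLAQUETTE `U(1)` FIELD,
HYPOTHESIS-FREE** (gen 27's `close112_smallField_of_inputs` with its two (H1.10″) inputs discharged by p27's `decay110_smallField_input` and
`decay110_smallPlaquette_cube_uniform`): for `1 ≤ d`, `d + 1 ≤ 3`, `ℓ ≥ 1` with `ℓ + 1` odd, `a > 0` there are `c₃, δ₃ > 0` such that for every volume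
(`P.d = d + 1`, `P.L = ℓ + 1`), every `1 ≤ k ≤ K` with `2(L^k − 1) + 4 < |T|`, every `u` with `‖u(∂p) − 1‖ ≤ θ`, `0 ≤ θ`, `(L^{2k}θ)² ≤ 1/500`,
every cube `□ = cubeT (L^k) c (L^kM)` (`M_i ≥ 1`, fitting, `L^kM_i < |T|`), every row `x ∈ □` with `dist_∞(x, T ∖ □) ≥ 10L^k` and every `f`
supported in `□`: `‖(G_k(□,u)f)(x) − (G_k(T,u)f)(x)‖ ≤ (L^kε)²·c₃e^{−δ₃D/L^k}e^{−δ₃(D_b+D_f)/L^k}·F`.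
[cite: Balaban1983RegularityDecay, Theorem p.573 (1.11)–(1.12)] [cite: BalabanImbrieJaffe1985, (7.3.1) p.326] -/
theorem close112_smallPlaquette_cube_torus (d ℓ : ℕ) (hd1 : 1 ≤ d) (hd3 : d + 1 ≤ 3) (hℓ : 1 ≤ ℓ) (hodd : Odd (ℓ + 1)) {a : ℝ} (ha : 0 < a) :
    ∃ c₃ δ₃ : ℝ, 0 < c₃ ∧ 0 < δ₃ ∧ ∀ (P : Params) (hPd : P.d = d + 1), P.L = ℓ + 1 →
      ∀ k : ℕ, 1 ≤ k → k ≤ P.K → 2 * (P.L ^ k - 1) + 4 < P.sitesPerDir 0 →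
      ∀ (U : GaugeField P 0 U1) (θ : ℝ), 0 ≤ θ → (∀ (y : Balaban1983to89.Site P 0) (μ ν : Fin P.d), ‖plaqC U y μ ν - 1‖ ≤ θ) →
        (((P.L : ℝ) ^ k) ^ 2 * θ) ^ 2 ≤ 1 / 500 →
      ∀ (c M : Fin (d + 1) → ℕ), (∀ i, 1 ≤ M i) → (∀ i, c i * P.L ^ k + P.L ^ k * M i ≤ P.sitesPerDir 0) →
        (∀ i, P.L ^ k * M i < P.sitesPerDir 0) →
      ∀ x ∈ cubeT hPd (P.L ^ k) c (fun i => P.L ^ k * M i),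
        (∀ w, w ∉ cubeT hPd (P.L ^ k) c (fun i => P.L ^ k * M i) → 10 * (P.L : ℝ) ^ k ≤ B5Ineq137Torus.T P 0 x w) →
      ∀ (f : Balaban1983to89.Site P 0 → ℂ) (F D Db Df : ℝ), (∀ y, ‖f y‖ ≤ F) →
        (∀ y, y ∉ cubeT hPd (P.L ^ k) c (fun i => P.L ^ k * M i) → f y = 0) →
        0 ≤ D → (∀ y, f y ≠ 0 → D ≤ B5Ineq137Torus.T P 0 x y) → 0 ≤ Db →
        (∀ w, w ∉ cubeT hPd (P.L ^ k) c (fun i => P.L ^ k * M i) → Db ≤ B5Ineq137Torus.T P 0 x w) →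
        0 ≤ Df → (∀ y, f y ≠ 0 → ∀ w, w ∉ cubeT hPd (P.L ^ k) c (fun i => P.L ^ k * M i) → Df ≤ B5Ineq137Torus.T P 0 y w) →
        ‖(gBox (B1RG242Torus.α P a k * (P.L : ℝ) ^ (k * P.d)) P.eps⁻¹ U k (cubeT hPd (P.L ^ k) c fun i => P.L ^ k * M i) *ᵥ f) x -
            (gBox (B1RG242Torus.α P a k * (P.L : ℝ) ^ (k * P.d)) P.eps⁻¹ U k univ *ᵥ f) x‖ ≤
          P.spacing k ^ 2 * (c₃ * Real.exp (-(δ₃ * (((P.L : ℝ) ^ k)⁻¹ * D))) *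
            Real.exp (-(δ₃ * (((P.L : ℝ) ^ k)⁻¹ * (Db + Df)))) * F) := by
  obtain ⟨δa, ca, hδa, hca, HA⟩ := decay110_smallField_input (d + 1) (ℓ + 1) (Nat.succ_pos d) hd3 ⟨hodd, by omega⟩ ha
  obtain ⟨δb, cb, hδb, hcb, HB⟩ := decay110_smallPlaquette_cube_uniform d ℓ hd3 hℓ ha
  have hcab : 0 ≤ max ca cb := hca.le.trans (le_max_left _ _)
  have hδab : 0 < min δa δb := lt_min hδa hδb
  obtain ⟨c₁, δ₁, hc₁, hδ₁, HC⟩ := close112_smallField_of_inputs (d + 1) (ℓ + 1) (by omega) hd3 ⟨hodd, by omega⟩ ha hcab hδab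
  refine ⟨c₁, δ₁, hc₁, hδ₁, ?_⟩
  intro P hPd hPL k hk1 hkK hbig U θ hθ0 hθ hτ c M hM hfit hN x hx hdeep f F D Db Df hF hfB hD hsD hDb hsDb hDf hsDf
  have hkm : k ≤ P.m + P.K := hkK.trans (Nat.le_add_left _ _)
  have hLr : (1 : ℝ) ≤ (P.L : ℝ) ^ k := one_le_pow₀ (B1RG242Torus.one_lt_cast_L P).le
  have hPk : (0 : ℝ) < (P.L : ℝ) ^ k := pow_pos P.cast_L_pos k
  have hdr : (P.d : ℝ) = (d : ℝ) + 1 := by rw [hPd]; push_cast; ring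
  have hd1r : (1 : ℝ) ≤ P.d := by rw [hdr]; linarith [(Nat.cast_nonneg d : (0 : ℝ) ≤ d)]
  have hd3r : (P.d : ℝ) ≤ 3 := by rw [hPd]; exact_mod_cast hd3
  obtain ⟨hsm1, hsm2⟩ := threshold_smallness hd1r hd3r hLr hθ0 hτ
  have hsk2 : 0 ≤ P.spacing k ^ 2 := sq_nonneg _
  have hplaq : ∀ p : Balaban1983to89.Plaq P 0, ‖toC (GaugeField.plaqHol U p) - 1‖ ≤ θ := by
    rintro ⟨y, μ, ν, hμν⟩
    rw [← plaqC_eq_toC_plaqHol U y hμν]; exact hθ y μ ν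
  have hT : ((P.d - 1 : ℕ) : ℝ) * ((P.L : ℝ) ^ k - 1) * θ ≤ ((P.d : ℝ) - 1) * ((P.L : ℝ) ^ k - 1) * θ := by
    rw [Nat.cast_sub P.hd, Nat.cast_one]
  -- the two value members at `(max ca cb, min δa δb)`
  have hGB : ∀ x ∈ cubeT hPd (P.L ^ k) c (fun i => P.L ^ k * M i), ∀ (f : Balaban1983to89.Site P 0 → ℂ) (F D : ℝ),
      (∀ y, ‖f y‖ ≤ F) → 0 ≤ D → (∀ y, f y ≠ 0 → D ≤ B5Ineq137Torus.T P 0 x y) →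
      ‖(gBox (B1RG242Torus.α P a k * (P.L : ℝ) ^ (k * P.d)) P.eps⁻¹ U k (cubeT hPd (P.L ^ k) c fun i => P.L ^ k * M i) *ᵥ f) x‖ ≤
        P.spacing k ^ 2 * (max ca cb * Real.exp (-(min δa δb * (((P.L : ℝ) ^ k)⁻¹ * D))) * F) := by
    intro x _ f F D hF hD hsupp
    have hF0 : 0 ≤ F := (norm_nonneg _).trans (hF x)
    refine (HB P hPd hPL k hk1 hkm hbig U θ hθ0 hplaq _ hT hsm2 c M hM hfit hN x f F D hF hsupp).trans ?_
    exact mul_le_mul_of_nonneg_left (mono_bound hcb.le (le_max_right _ _) (min_le_right _ _) (mul_nonneg (inv_pos.2 hPk).le hD) hF0) hsk2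
  have hGΩ : ∀ x ∈ cubeT hPd (P.L ^ k) c (fun i => P.L ^ k * M i), ∀ (f : Balaban1983to89.Site P 0 → ℂ) (F D : ℝ),
      (∀ y, ‖f y‖ ≤ F) → 0 ≤ D → (∀ y, f y ≠ 0 → D ≤ B5Ineq137Torus.T P 0 x y) →
      ‖(gBox (B1RG242Torus.α P a k * (P.L : ℝ) ^ (k * P.d)) P.eps⁻¹ U k univ *ᵥ f) x‖ ≤
        P.spacing k ^ 2 * (max ca cb * Real.exp (-(min δa δb * (((P.L : ℝ) ^ k)⁻¹ * D))) * F) := by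
    intro x _ f F D hF hD hsupp
    have hF0 : 0 ≤ F := (norm_nonneg _).trans (hF x)
    refine (HA P hPd hPL k hk1 hkK U θ hθ hsm1 x f F D hF hsupp).trans ?_
    exact mul_le_mul_of_nonneg_left (mono_bound hca.le (le_max_left _ _) (min_le_left _ _) (mul_nonneg (inv_pos.2 hPk).le hD) hF0) hsk2
  exact HC P hPd hPL k hk1 hkK U θ hθ hsm1 _ univ (isBlockUnion_cubeT hPd hkm rfl hfit) (isBlockUnion_univ k) (subset_univ _) hGB hGΩ x hx
    hdeep f F D Db Df hF hfB hD hsD hDb hsDb hDf hsDf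

/-! ## §3 The covariant-derivative member for (torus cube, whole torus), hypothesis-free -/

/-- **[Balaban1983RegularityDecay] (1.11)–(1.12), COVARIANT-DERIVATIVE MEMBER, FOR A TORUS CUBE AGAINST THE WHOLE TORUS AT A SMALL-PLAQUETTE
`U(1)` FIELD, HYPOTHESIS-FREE** (gen 28's `close112_smallField_deriv_of_inputs` with its four (H1.10″) inputs discharged by p27's
`decay110_smallField_input` / `decay110_smallPlaquette_cube_uniform` (values), gen 25's `decay110_smallField_deriv` and p34's
`decay110_smallPlaquette_cube_deriv_uniform_input` (covariant derivatives)): for `1 ≤ d`, `d + 1 ≤ 3`, `ℓ ≥ 1` with `ℓ + 1` odd, `a > 0`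
there are `c₃, δ₃ > 0` such that for every volume (`P.d = d + 1`, `P.L = ℓ + 1`), every `1 ≤ k ≤ K` with `2(L^k − 1) + 4 < |T|`, every `u`
with `‖u(∂p) − 1‖ ≤ θ`, `0 ≤ θ`, `(L^{2k}θ)² ≤ 1/500`, every cube `□ = cubeT (L^k) c (L^kM)` (`M_i ≥ 1`, fitting, `L^kM_i < |T|`), every row
`x ∈ □` with `dist_∞(x, T ∖ □) ≥ 14L^k`, every `f` supported in `□` and every `μ`:
`‖covD ε⁻¹ u (G_k(□,u)f) ⟨x,μ⟩ − covD ε⁻¹ u (G_k(T,u)f) ⟨x,μ⟩‖ ≤ (L^kε)·c₃e^{−δ₃D/L^k}e^{−δ₃(D_b+D_f)/L^k}·F`.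
[cite: Balaban1983RegularityDecay, Theorem p.573 (1.10)–(1.12)] [cite: BalabanImbrieJaffe1985, (7.3.1) p.326] -/
theorem close112_smallPlaquette_cube_torus_deriv (d ℓ : ℕ) (hd1 : 1 ≤ d) (hd3 : d + 1 ≤ 3) (hℓ : 1 ≤ ℓ) (hodd : Odd (ℓ + 1)) {a : ℝ}
    (ha : 0 < a) :
    ∃ c₃ δ₃ : ℝ, 0 < c₃ ∧ 0 < δ₃ ∧ ∀ (P : Params) (hPd : P.d = d + 1), P.L = ℓ + 1 →
      ∀ k : ℕ, 1 ≤ k → k ≤ P.K → 2 * (P.L ^ k - 1) + 4 < P.sitesPerDir 0 →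
      ∀ (U : GaugeField P 0 U1) (θ : ℝ), 0 ≤ θ → (∀ (y : Balaban1983to89.Site P 0) (μ ν : Fin P.d), ‖plaqC U y μ ν - 1‖ ≤ θ) →
        (((P.L : ℝ) ^ k) ^ 2 * θ) ^ 2 ≤ 1 / 500 →
      ∀ (c M : Fin (d + 1) → ℕ), (∀ i, 1 ≤ M i) → (∀ i, c i * P.L ^ k + P.L ^ k * M i ≤ P.sitesPerDir 0) →
        (∀ i, P.L ^ k * M i < P.sitesPerDir 0) →
      ∀ x ∈ cubeT hPd (P.L ^ k) c (fun i => P.L ^ k * M i),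
        (∀ w, w ∉ cubeT hPd (P.L ^ k) c (fun i => P.L ^ k * M i) → 14 * (P.L : ℝ) ^ k ≤ B5Ineq137Torus.T P 0 x w) →
      ∀ (f : Balaban1983to89.Site P 0 → ℂ) (F D Db Df : ℝ), (∀ y, ‖f y‖ ≤ F) →
        (∀ y, y ∉ cubeT hPd (P.L ^ k) c (fun i => P.L ^ k * M i) → f y = 0) →
        0 ≤ D → (∀ y, f y ≠ 0 → D ≤ B5Ineq137Torus.T P 0 x y) → 0 ≤ Db →
        (∀ w, w ∉ cubeT hPd (P.L ^ k) c (fun i => P.L ^ k * M i) → Db ≤ B5Ineq137Torus.T P 0 x w) →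
        0 ≤ Df → (∀ y, f y ≠ 0 → ∀ w, w ∉ cubeT hPd (P.L ^ k) c (fun i => P.L ^ k * M i) → Df ≤ B5Ineq137Torus.T P 0 y w) →
        ∀ (μ : Fin P.d),
        ‖covD P.eps⁻¹ (cfg U) (gBox (B1RG242Torus.α P a k * (P.L : ℝ) ^ (k * P.d)) P.eps⁻¹ U k
              (cubeT hPd (P.L ^ k) c fun i => P.L ^ k * M i) *ᵥ f) ⟨x, μ⟩ -
            covD P.eps⁻¹ (cfg U) (gBox (B1RG242Torus.α P a k * (P.L : ℝ) ^ (k * P.d)) P.eps⁻¹ U k univ *ᵥ f) ⟨x, μ⟩‖ ≤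
          P.spacing k * (c₃ * Real.exp (-(δ₃ * (((P.L : ℝ) ^ k)⁻¹ * D))) *
            Real.exp (-(δ₃ * (((P.L : ℝ) ^ k)⁻¹ * (Db + Df)))) * F) := by
  obtain ⟨δa, ca, hδa, hca, HA⟩ := decay110_smallField_input (d + 1) (ℓ + 1) (Nat.succ_pos d) hd3 ⟨hodd, by omega⟩ ha
  obtain ⟨δb, cb, hδb, hcb, HB⟩ := decay110_smallPlaquette_cube_uniform d ℓ hd3 hℓ ha
  obtain ⟨tc, cc, htc, hcc, HCd⟩ := decay110_smallField_deriv (d + 1) (ℓ + 1) (by omega) hd3 ⟨hodd, by omega⟩ ha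
  obtain ⟨td, cd, htd, hcd, HDd⟩ := decay110_smallPlaquette_cube_deriv_uniform_input d (ℓ + 1) hd1 hd3 ⟨hodd, by omega⟩ ha
  set c₀ : ℝ := max (max ca cb) (max cc cd) with hc₀def
  set δ₀ : ℝ := min (min δa δb) (min tc td) with hδ₀def
  have hc₀ : 0 ≤ c₀ := hca.le.trans ((le_max_left _ _).trans (le_max_left _ _))
  have hδ₀ : 0 < δ₀ := lt_min (lt_min hδa hδb) (lt_min htc htd)
  have hca' : ca ≤ c₀ := (le_max_left _ _).trans (le_max_left _ _)
  have hcb' : cb ≤ c₀ := (le_max_right _ _).trans (le_max_left _ _)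
  have hcc' : cc ≤ c₀ := (le_max_left _ _).trans (le_max_right _ _)
  have hcd' : cd ≤ c₀ := (le_max_right _ _).trans (le_max_right _ _)
  have hδa' : δ₀ ≤ δa := (min_le_left _ _).trans (min_le_left _ _)
  have hδb' : δ₀ ≤ δb := (min_le_left _ _).trans (min_le_right _ _)
  have htc' : δ₀ ≤ tc := (min_le_right _ _).trans (min_le_left _ _)
  have htd' : δ₀ ≤ td := (min_le_right _ _).trans (min_le_right _ _)
  obtain ⟨c₂, δ₂, hc₂, hδ₂, H⟩ := close112_smallField_deriv_of_inputs (d + 1) (ℓ + 1) (by omega) hd3 ⟨hodd, by omega⟩ ha hc₀ hδ₀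
  refine ⟨c₂, δ₂, hc₂, hδ₂, ?_⟩
  intro P hPd hPL k hk1 hkK hbig U θ hθ0 hθ hτ c M hM hfit hN x hx hdeep f F D Db Df hF hfB hD hsD hDb hsDb hDf hsDf μ
  have hkm : k ≤ P.m + P.K := hkK.trans (Nat.le_add_left _ _)
  have hLr : (1 : ℝ) ≤ (P.L : ℝ) ^ k := one_le_pow₀ (B1RG242Torus.one_lt_cast_L P).le
  have hPk : (0 : ℝ) < (P.L : ℝ) ^ k := pow_pos P.cast_L_pos k
  have hdr : (P.d : ℝ) = (d : ℝ) + 1 := by rw [hPd]; push_cast; ring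
  have hd1r : (1 : ℝ) ≤ P.d := by rw [hdr]; linarith [(Nat.cast_nonneg d : (0 : ℝ) ≤ d)]
  have hd3r : (P.d : ℝ) ≤ 3 := by rw [hPd]; exact_mod_cast hd3
  obtain ⟨hsm1, hsm2⟩ := threshold_smallness hd1r hd3r hLr hθ0 hτ
  have hsk2 : 0 ≤ P.spacing k ^ 2 := sq_nonneg _
  have hsk : 0 ≤ P.spacing k := (P.spacing_pos k).le
  have hplaq : ∀ p : Balaban1983to89.Plaq P 0, ‖toC (GaugeField.plaqHol U p) - 1‖ ≤ θ := by
    rintro ⟨y, μ, ν, hμν⟩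
    rw [← plaqC_eq_toC_plaqHol U y hμν]; exact hθ y μ ν
  have hT : ((P.d - 1 : ℕ) : ℝ) * ((P.L : ℝ) ^ k - 1) * θ ≤ ((P.d : ℝ) - 1) * ((P.L : ℝ) ^ k - 1) * θ := by
    rw [Nat.cast_sub P.hd, Nat.cast_one]
  -- the two value members at `(c₀, δ₀)`
  have hGB : ∀ x ∈ cubeT hPd (P.L ^ k) c (fun i => P.L ^ k * M i), ∀ (f : Balaban1983to89.Site P 0 → ℂ) (F D : ℝ),
      (∀ y, ‖f y‖ ≤ F) → 0 ≤ D → (∀ y, f y ≠ 0 → D ≤ B5Ineq137Torus.T P 0 x y) →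
      ‖(gBox (B1RG242Torus.α P a k * (P.L : ℝ) ^ (k * P.d)) P.eps⁻¹ U k (cubeT hPd (P.L ^ k) c fun i => P.L ^ k * M i) *ᵥ f) x‖ ≤
        P.spacing k ^ 2 * (c₀ * Real.exp (-(δ₀ * (((P.L : ℝ) ^ k)⁻¹ * D))) * F) := by
    intro x _ f F D hF hD hsupp
    have hF0 : 0 ≤ F := (norm_nonneg _).trans (hF x)
    refine (HB P hPd hPL k hk1 hkm hbig U θ hθ0 hplaq _ hT hsm2 c M hM hfit hN x f F D hF hsupp).trans ?_
    exact mul_le_mul_of_nonneg_left (mono_bound hcb.le hcb' hδb' (mul_nonneg (inv_pos.2 hPk).le hD) hF0) hsk2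
  have hGΩ : ∀ x ∈ cubeT hPd (P.L ^ k) c (fun i => P.L ^ k * M i), ∀ (f : Balaban1983to89.Site P 0 → ℂ) (F D : ℝ),
      (∀ y, ‖f y‖ ≤ F) → 0 ≤ D → (∀ y, f y ≠ 0 → D ≤ B5Ineq137Torus.T P 0 x y) →
      ‖(gBox (B1RG242Torus.α P a k * (P.L : ℝ) ^ (k * P.d)) P.eps⁻¹ U k univ *ᵥ f) x‖ ≤
        P.spacing k ^ 2 * (c₀ * Real.exp (-(δ₀ * (((P.L : ℝ) ^ k)⁻¹ * D))) * F) := by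
    intro x _ f F D hF hD hsupp
    have hF0 : 0 ≤ F := (norm_nonneg _).trans (hF x)
    refine (HA P hPd hPL k hk1 hkK U θ hθ hsm1 x f F D hF hsupp).trans ?_
    exact mul_le_mul_of_nonneg_left (mono_bound hca.le hca' hδa' (mul_nonneg (inv_pos.2 hPk).le hD) hF0) hsk2
  -- the two covariant-derivative members at `(c₀, δ₀)`
  have hDB : ∀ x, (∀ y, B5Ineq137Torus.T P 0 x y < (P.L : ℝ) ^ k → y ∈ cubeT hPd (P.L ^ k) c (fun i => P.L ^ k * M i)) →
      ∀ (f : Balaban1983to89.Site P 0 → ℂ) (F D : ℝ), (∀ y, ‖f y‖ ≤ F) → 0 ≤ D → (∀ y, f y ≠ 0 → D ≤ B5Ineq137Torus.T P 0 x y) →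
      ∀ (μ : Fin P.d), ‖covD P.eps⁻¹ (cfg U) (gBox (B1RG242Torus.α P a k * (P.L : ℝ) ^ (k * P.d)) P.eps⁻¹ U k
          (cubeT hPd (P.L ^ k) c fun i => P.L ^ k * M i) *ᵥ f) ⟨x, μ⟩‖ ≤
        P.spacing k * (c₀ * Real.exp (-(δ₀ * (((P.L : ℝ) ^ k)⁻¹ * D))) * F) := by
    intro x hball f F D hF hD hsupp μ
    have hF0 : 0 ≤ F := (norm_nonneg _).trans (hF x)
    refine (HDd P hPd hPL k hk1 hkK hbig U θ hθ0 hplaq hsm1 _ hT hsm2 c M hM hfit hN x hball f F D hF hsupp μ).trans ?_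
    exact mul_le_mul_of_nonneg_left (mono_bound hcd.le hcd' htd' (mul_nonneg (inv_pos.2 hPk).le hD) hF0) hsk
  have hDΩ : ∀ x, (∀ y, B5Ineq137Torus.T P 0 x y < (P.L : ℝ) ^ k → y ∈ cubeT hPd (P.L ^ k) c (fun i => P.L ^ k * M i)) →
      ∀ (f : Balaban1983to89.Site P 0 → ℂ) (F D : ℝ), (∀ y, ‖f y‖ ≤ F) → 0 ≤ D → (∀ y, f y ≠ 0 → D ≤ B5Ineq137Torus.T P 0 x y) →
      ∀ (μ : Fin P.d), ‖covD P.eps⁻¹ (cfg U) (gBox (B1RG242Torus.α P a k * (P.L : ℝ) ^ (k * P.d)) P.eps⁻¹ U k univ *ᵥ f) ⟨x, μ⟩‖ ≤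
        P.spacing k * (c₀ * Real.exp (-(δ₀ * (((P.L : ℝ) ^ k)⁻¹ * D))) * F) := by
    intro x _ f F D hF hD hsupp μ
    have hF0 : 0 ≤ F := (norm_nonneg _).trans (hF x)
    have h := HCd P hPd hPL k hk1 hkK U θ hθ hsm1 x μ f F D hF
      (fun z hz => by rw [← B3Bound323ZeroTorus.T_eq_supDist]; exact hsupp z hz)
    have e : cc * P.spacing k * Real.exp (-(tc * D / (P.L : ℝ) ^ k)) * F =
        P.spacing k * (cc * Real.exp (-(tc * (((P.L : ℝ) ^ k)⁻¹ * D))) * F) := by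
      rw [show tc * D / (P.L : ℝ) ^ k = tc * (((P.L : ℝ) ^ k)⁻¹ * D) by rw [div_eq_mul_inv]; ring]; ring
    rw [e] at h
    refine h.trans ?_
    exact mul_le_mul_of_nonneg_left (mono_bound hcc.le hcc' htc' (mul_nonneg (inv_pos.2 hPk).le hD) hF0) hsk
  exact H P hPd hPL k hk1 hkK U θ hθ hsm1 _ univ (isBlockUnion_cubeT hPd hkm rfl hfit) (isBlockUnion_univ k) (subset_univ _) hGB hGΩ hDB hDΩ
    x hx hdeep f F D Db Df hF hfB hD hsD hDb hsDb hDf hsDf μ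

end

end Literature.MathematicalPhysics.QuantumFieldTheory.BalabanImbrieJaffe1984to88.BIJ88NeumannPropagatorSmallFieldCloseCubeTorus
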